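import Summits.ABC.StewartYu.YuNinetyOddTransfer
import Summits.ABC.ABC.Theses.PadicPrimesYuNinety
import Summits.ABC.StewartYu.KappaDoorEpsShape
import Literature.Barriers.ABC.BakerMethodBoundsEpsShape
import HarnessLib

/-!
# Cell abc-stewartyu: the payoff of the two ODD-prime engines — Yu 1990 at `p ≡ 3` and `p ≡ 1 (mod 4)`
# give `log c ≪_ε rad(abc)^{1+ε}` (the leaf `EpsShapeBoundOne`), without any `2`-adic engine

`Summits/ABC/StewartYu/YuNinetyOddRadOne.lean` — cell `abc-stewartyu` (HOME
`run/shared/lean/pub/abc-stewartyu/`, seat p3; theorems only, no definition, no named fact).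

This is the by-name record of the planner's staged rung route A1.M2⁻ `PadicPrimesYuNinetyOddRadOne`
(HOME/plan/routes/RouteM2minus.md; STATUS 2026-08-26T03:27:58Z): the texts of the cruxes
`YuNinetyThreeModFour` (stmt-ABC-19249) and `YuNinetyOneModFour` (stmt-ABC-19250) of route
`PadicPrimesYuNinety` — taken here as HYPOTHESES, verbatim — imply the leaf
`Literature.Barriers.ABC.EpsShapeBoundOne` (`∀ ε > 0 ∃ κ c₀, log c ≤ κ·rad(abc)^{1+ε}` for every abc
triple with `c ≥ c₀`) through the odd transfer (`YuNinetyOdd.finBoundAt_of_residueClasses`, this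
seat's `YuNinetyOddTransfer.lean`) and the cell's landed odd κ-door
(`KappaDoor.epsShapeBound_of_oddFinBound` with `(κ, σ, τ, τ₁) = (1, 2, 1, 1)`, `max 1 1 = 1`).
So the minute both odd engines land, `rad^{1+ε}` is a tree theorem by `exact` — below every rung of the
principal-unit ladder (`3+ε`, `5/2+ε` landed) — and the route's Assembly item closes by this term.

Main results: `YuNinetyOdd.epsShapeBound_one_of_residueClasses` (unbundled constants) and
`YuNinetyOdd.epsShapeBoundOne_of_yuNinety_odd` (the leaf BY NAME from the two crux texts).
Everything is [folklore] composition; the two `p`-adic estimates are hypotheses (the XL stubs).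
WHAT THIS IS NOT: no `p`-adic estimate is proved here; this is a CONDITIONAL rung record.
-/

noncomputable section

open Finset Real

namespace Summit.ABC.StewartYu

namespace YuNinetyOdd

open KappaDoor Literature.Barriers.ABC

/-- **`EpsShapeBound 1` from the two residue-class estimates (unbundled).** [folklore] -/
theorem epsShapeBound_one_of_residueClasses {c₅ c₅' : ℝ}
    (h₃ : ∀ (p : ℕ), p.Prime → p % 4 = 3 → ∀ (S : Finset ℕ), (∀ q ∈ S, q.Prime) → p ∉ S →
      S.Nonempty → ∀ (e : ℕ → ℤ) (B : ℝ), 3 ≤ B → (∀ q ∈ S, (|e q| : ℝ) ≤ B) →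
      ∏ q ∈ S, (q : ℚ) ^ e q ≠ 1 →
      (padicValRat p (∏ q ∈ S, (q : ℚ) ^ e q - 1) : ℝ) <
        (c₅ * S.card) ^ S.card * (p : ℝ) ^ 2 * Real.log B *
          Real.log (Real.log ((max 4 (S.sup id) : ℕ) : ℝ)) * ∏ q ∈ S, Real.log ((max 4 q : ℕ) : ℝ))
    (h₁ : ∀ (p : ℕ), p.Prime → p % 4 = 1 → ∀ (S : Finset ℕ), (∀ q ∈ S, q.Prime) → p ∉ S →
      S.Nonempty → ∀ (e : ℕ → ℤ) (B : ℝ), 3 ≤ B → (∀ q ∈ S, (|e q| : ℝ) ≤ B) →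
      ∏ q ∈ S, (q : ℚ) ^ e q ≠ 1 →
      (padicValRat p (∏ q ∈ S, (q : ℚ) ^ e q - 1) : ℝ) <
        (c₅' * S.card) ^ S.card * (p : ℝ) ^ 2 * Real.log B *
          Real.log (Real.log ((max 4 (S.sup id) : ℕ) : ℝ)) * ∏ q ∈ S, Real.log ((max 4 q : ℕ) : ℝ)) :
    EpsShapeBound 1 := by
  have hL : (1 : ℝ) ≤ 2 * max 1 (max |c₅| |c₅'|) := by
    have : (1 : ℝ) ≤ max 1 (max |c₅| |c₅'|) := le_max_left _ _
    linarith
  have h := epsShapeBound_of_oddFinBound (K := 2) (L := 2 * max 1 (max |c₅| |c₅'|)) (κ := 1)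
    (σ := 2) (τ := 1) (τ₁ := 1) (by norm_num) hL zero_le_two le_rfl
    (fun p hp hp2 => finBoundAt_of_residueClasses h₃ h₁ hp hp2)
  rwa [max_self] at h

/-- **The leaf `EpsShapeBoundOne` (`log c ≪_ε rad(abc)^{1+ε}`) from the texts of the two odd cruxes
`YuNinetyThreeModFour` and `YuNinetyOneModFour` of route `PadicPrimesYuNinety`, BY NAME** — the
payoff of the odd-prime engines alone (rung A1.M2⁻). [folklore] -/
theorem epsShapeBoundOne_of_yuNinety_odd
    (h₃ : ∃ c₅ : ℝ, ∀ (p : ℕ), p.Prime → p % 4 = 3 → ∀ (S : Finset ℕ), (∀ q ∈ S, q.Prime) → p ∉ S →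
      S.Nonempty → ∀ (e : ℕ → ℤ) (B : ℝ), 3 ≤ B → (∀ q ∈ S, (|e q| : ℝ) ≤ B) →
      ∏ q ∈ S, (q : ℚ) ^ e q ≠ 1 →
      (padicValRat p (∏ q ∈ S, (q : ℚ) ^ e q - 1) : ℝ) <
        (c₅ * S.card) ^ S.card * (p : ℝ) ^ 2 * Real.log B *
          Real.log (Real.log ((max 4 (S.sup id) : ℕ) : ℝ)) * ∏ q ∈ S, Real.log ((max 4 q : ℕ) : ℝ))
    (h₁ : ∃ c₅ : ℝ, ∀ (p : ℕ), p.Prime → p % 4 = 1 → ∀ (S : Finset ℕ), (∀ q ∈ S, q.Prime) → p ∉ S →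
      S.Nonempty → ∀ (e : ℕ → ℤ) (B : ℝ), 3 ≤ B → (∀ q ∈ S, (|e q| : ℝ) ≤ B) →
      ∏ q ∈ S, (q : ℚ) ^ e q ≠ 1 →
      (padicValRat p (∏ q ∈ S, (q : ℚ) ^ e q - 1) : ℝ) <
        (c₅ * S.card) ^ S.card * (p : ℝ) ^ 2 * Real.log B *
          Real.log (Real.log ((max 4 (S.sup id) : ℕ) : ℝ)) * ∏ q ∈ S, Real.log ((max 4 q : ℕ) : ℝ)) :
    Literature.Barriers.ABC.EpsShapeBoundOne := by
  obtain ⟨c₅, h₃⟩ := h₃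
  obtain ⟨c₅', h₁⟩ := h₁
  exact epsShapeBound_one_of_residueClasses h₃ h₁

/-- The same with the cruxes named: `YuNinetyThreeModFour → YuNinetyOneModFour → EpsShapeBoundOne`
(the route decls of `Summits/ABC/ABC/Theses/PadicPrimesYuNinety.lean`, unfolded by `Iff.rfl`).
[folklore] -/
theorem epsShapeBoundOne_of_cruxes
    (h₃ : Summit.ABC.ABC.Theses.PadicPrimesYuNinety.YuNinetyThreeModFour)
    (h₁ : Summit.ABC.ABC.Theses.PadicPrimesYuNinety.YuNinetyOneModFour) :
    Literature.Barriers.ABC.EpsShapeBoundOne :=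
  epsShapeBoundOne_of_yuNinety_odd h₃ h₁

end YuNinetyOdd

end Summit.ABC.StewartYu

end
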